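import Summits.CriticalPhenomena.PercolationContinuityZ3.Theorems.Transplant.FKConnectivityAllQPat3TwoLevelDefs
import HarnessLib

/-!
# Connectivity correlation inequalities for `φ_{w,q}`, every `q > 0` — LEVELWISE VALUES of two-level three-mark members and the
# regrouping tools for product-cone certificates (Stage S2, part 2a)

Definitions + theorems file (`--supports stmt-CriticalPhenomena-4575`), census lane `prim-bschramm-census` (gen 36) of the post-continuity programme (LANE 2 bschramm, FK sub-lane);
builds on p205010 (kernel theorem, internal audit signed; external expert review pending).
No named facts, no sorries; standard axioms.  `FK.lev2 E x y s F μ` — the value of a two-level member at level `μ` (an integer;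
census g34's `f(H)(ν)` up to the constant level offset); `FK.lev2_cast` (= `FK.mval2` against the indicator weight of the level),
`FK.lev2_nonneg_of_mval2` (valid for all nonnegative weights ⇒ valid levelwise: how THEOREMS 𝒯₁/𝒯₂/U enter the product-cone
lemma), `FK.lev2_eq_sum`, `FK.mval2_eq_tval_add`; relabelling of the marks (`FK.pat3_swap_xy/_ys`, `FK.lev2_swap_xy/_ys`, `FK.Pat3.swap23`, `FK.mirror23`); level sums and `T_sym` symmetry (`FK.mval2_eq_sum_lev2`, `FK.mval2_nonneg_of_lev2`, `FK.mval2_tsym2Tab`, `FK.tval_tsym_nonneg_of_lev2`, `FK.tval_swap_xy/_ys`, `FK.tsymTab_swap/_swap23`, `FK.tval_tsym_nonneg_perm`); and the bookkeeping behind the product-cone lemma of `…Pat3Cone.lean`: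
`FK.sum3_collapse`, `FK.ite_sum_zero`, `FK.sum_range_ite_collapse`, `FK.ite_eq_ite_of_iff`, **`FK.regroup1`** (single-piece
regrouping: summing a generator's guarded contributions over one piece's configurations gives its levelwise values).
[cite: AyyerLinussonRavichandran2025, §7 (p. 22)] [cite: Grimmett2006, §3.8 (pp. 61–62)]
-/

noncomputable section

namespace Summit.CriticalPhenomena.PercolationContinuityZ3.Theorems

namespace FK

open SimpleGraph Literature.Probability.LatticeModels Literature.Probability.Percolation

/-! ### Levelwise values of two-level members -/

section Levels

open scoped Classical

variable {V : Type*}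

/-- **Levelwise value** of a two-level member `F` on the three-mark network `(E; x, y, s)` at level `μ` (an integer):
`lev2 E x y s F μ = Σ_{γ ⊆ E} (1{k+k̄ = μ} F 0 (pat γ, pat γᶜ) + 1{k+k̄+1 = μ} F 1 (pat γ, pat γᶜ))` — the value of census g34's
functional at level `μ` (up to the constant level offset). [folklore] -/
noncomputable def lev2 (E : Finset (Sym2 V)) (x y s : V) (F : ℕ → Pat3 → Pat3 → ℤ) (μ : ℕ) : ℤ :=
  ∑ γ ∈ E.powerset, ((if apExp E γ = μ then F 0 (pat3 γ x y s) (pat3 (E \ γ) x y s) else 0) +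
    (if apExp E γ + 1 = μ then F 1 (pat3 γ x y s) (pat3 (E \ γ) x y s) else 0))

/-- The levelwise value is the weighted evaluation against the indicator weight of the level. [folklore] -/
theorem lev2_cast (E : Finset (Sym2 V)) (x y s : V) (F : ℕ → Pat3 → Pat3 → ℤ) (μ : ℕ) :
    (lev2 E x y s F μ : ℝ) = mval2 (fun n => if n = μ then (1 : ℝ) else 0) E x y s F := by
  unfold lev2 mval2
  push_cast
  refine Finset.sum_congr rfl fun γ _ => ?_
  by_cases h0 : apExp E γ = μ <;> by_cases h1 : apExp E γ + 1 = μ <;> simp [h0, h1]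

/-- A member nonnegative for all nonnegative weights is nonnegative at every level. [folklore] -/
theorem lev2_nonneg_of_mval2 {E : Finset (Sym2 V)} {x y s : V} {F : ℕ → Pat3 → Pat3 → ℤ}
    (h : ∀ w : ℕ → ℝ, (∀ n, 0 ≤ w n) → 0 ≤ mval2 w E x y s F) (μ : ℕ) : 0 ≤ lev2 E x y s F μ := by
  have := h (fun n => if n = μ then (1 : ℝ) else 0) (fun n => by split_ifs <;> norm_num)
  rw [← lev2_cast] at this
  exact_mod_cast this

/-- `lev2` with the two levels written as a sum over `c < 2`. [folklore] -/
theorem lev2_eq_sum (E : Finset (Sym2 V)) (x y s : V) (F : ℕ → Pat3 → Pat3 → ℤ) (μ : ℕ) :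
    lev2 E x y s F μ = ∑ γ ∈ E.powerset, ∑ c ∈ Finset.range 2,
      (if apExp E γ + c = μ then F c (pat3 γ x y s) (pat3 (E \ γ) x y s) else 0) := by
  unfold lev2
  refine Finset.sum_congr rfl fun γ _ => ?_
  rw [Finset.sum_range_succ, Finset.sum_range_succ, Finset.sum_range_zero, zero_add, add_zero]

end Levels


/-! ### Bookkeeping for levelwise regrouping -/

section LevelTools

open scoped Classical

variable {V : Type*}

/-- Three nested level sums against level indicators collapse to one indicator. [folklore] -/
theorem sum3_collapse (N κ eK e1 e2 : ℕ) (x y z : ℤ) :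
    (∑ μK ∈ Finset.range (N + 1), ∑ μ1 ∈ Finset.range (N + 1), ∑ μ2 ∈ Finset.range (N + 1),
      if μK + μ1 + μ2 + κ = N then
        (if eK = μK then x else 0) * (if e1 = μ1 then y else 0) * (if e2 = μ2 then z else 0) else 0) =
      if eK + e1 + e2 + κ = N then x * y * z else 0 := by
  rw [Finset.sum_eq_single eK]
  · rw [Finset.sum_eq_single e1]
    · rw [Finset.sum_eq_single e2]
      · simp
      · intro μ2 _ hne
        rw [if_neg (Ne.symm hne), mul_zero, ite_self]
      · intro hmem
        rw [Finset.mem_range, not_lt] at hmem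
        have : ¬ (eK + e1 + e2 + κ = N) := by omega
        rw [if_neg this]
    · intro μ1 _ hne
      refine Finset.sum_eq_zero fun μ2 _ => ?_
      rw [if_neg (Ne.symm hne), mul_zero, zero_mul, ite_self]
    · intro hmem
      rw [Finset.mem_range, not_lt] at hmem
      refine Finset.sum_eq_zero fun μ2 _ => ?_
      have : ¬ (eK + e1 + μ2 + κ = N) := by omega
      rw [if_neg this]
  · intro μK _ hne
    refine Finset.sum_eq_zero fun μ1 _ => Finset.sum_eq_zero fun μ2 _ => ?_
    rw [if_neg (Ne.symm hne), zero_mul, zero_mul, ite_self]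
  · intro hmem
    rw [Finset.mem_range, not_lt] at hmem
    refine Finset.sum_eq_zero fun μ1 _ => Finset.sum_eq_zero fun μ2 _ => ?_
    have : ¬ (eK + μ1 + μ2 + κ = N) := by omega
    rw [if_neg this]

/-- Pushing an `if` over a finite sum. [folklore] -/
theorem ite_sum_zero {ι : Type*} (S : Finset ι) (p : Prop) [Decidable p] (f : ι → ℤ) :
    (if p then ∑ i ∈ S, f i else 0) = ∑ i ∈ S, (if p then f i else 0) := by
  split_ifs with h
  · rfl
  · simp

/-- Collapsing a level sum against a nested indicator. [folklore] -/
theorem sum_range_ite_collapse (N e m : ℕ) (x : ℤ) :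
    (∑ d ∈ Finset.range (N + 1), if e + d = N then (if m = d then x else 0) else 0) = if e + m = N then x else 0 := by
  rw [Finset.sum_eq_single m]
  · by_cases h : e + m = N
    · rw [if_pos h, if_pos rfl, if_pos h]
    · rw [if_neg h, if_neg h]
  · intro d _ hne
    rw [if_neg (Ne.symm hne), ite_self]
  · intro hmem
    rw [Finset.mem_range, not_lt] at hmem
    have : ¬ (e + m = N) := by omega
    rw [if_neg this]

/-- `mval2` as two one-level evaluations. [folklore] -/
theorem mval2_eq_tval_add (w : ℕ → ℝ) (E : Finset (Sym2 V)) (x y s : V) (F : ℕ → Pat3 → Pat3 → ℤ) :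
    mval2 w E x y s F = tval w E x y s (F 0) + tval (fun n => w (n + 1)) E x y s (F 1) := by
  unfold mval2 tval
  rw [← Finset.sum_add_distrib]

/-- Two guarded terms agree when the guards are equivalent and the terms equal. [folklore] -/
theorem ite_eq_ite_of_iff {P Q : Prop} [Decidable P] [Decidable Q] (h : P ↔ Q) {x y : ℤ} (hxy : x = y) :
    (if P then x else 0) = (if Q then y else 0) := by
  by_cases hP : P
  · rw [if_pos hP, if_pos (h.1 hP), hxy]
  · rw [if_neg hP, if_neg (fun hQ => hP (h.2 hQ))]

/-- **Single-piece regrouping**: summing a generator's contributions over the configurations of one piece, against a level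
constraint, gives its levelwise values. [folklore] -/
theorem regroup1 (E : Finset (Sym2 V)) (x y s : V) (g : ℕ → Pat3 → Pat3 → ℤ) (N r : ℕ) (z : ℤ) :
    (∑ γ ∈ E.powerset, ∑ k ∈ Finset.range 2,
      (if apExp E γ + k + r = N then g k (pat3 γ x y s) (pat3 (E \ γ) x y s) * z else 0)) =
      ∑ μ ∈ Finset.range (N + 1), (if μ + r = N then lev2 E x y s g μ * z else 0) := by
  have rhs : ∀ μ ∈ Finset.range (N + 1), (if μ + r = N then lev2 E x y s g μ * z else 0) =
      ∑ γ ∈ E.powerset, ∑ k ∈ Finset.range 2,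
        (if μ + r = N then (if apExp E γ + k = μ then g k (pat3 γ x y s) (pat3 (E \ γ) x y s) else 0) * z else 0) := by
    intro μ _
    rw [lev2_eq_sum, Finset.sum_mul, ite_sum_zero]
    refine Finset.sum_congr rfl fun γ _ => ?_
    rw [Finset.sum_mul, ite_sum_zero]
  rw [Finset.sum_congr rfl rhs]
  symm
  conv_lhs => rw [Finset.sum_comm]
  refine Finset.sum_congr rfl fun γ _ => ?_
  conv_lhs => rw [Finset.sum_comm]
  refine Finset.sum_congr rfl fun k _ => ?_
  rw [Finset.sum_eq_single (apExp E γ + k)]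
  · by_cases h : apExp E γ + k + r = N
    · rw [if_pos h, if_pos rfl, if_pos h]
    · rw [if_neg h, if_neg h]
  · intro μ _ hne
    rw [if_neg (Ne.symm hne), zero_mul, ite_self]
  · intro hmem
    rw [Finset.mem_range, not_lt] at hmem
    have : ¬ (apExp E γ + k + r = N) := by omega
    rw [if_neg this]


end LevelTools


/-! ### Relabelling the marks (census g36): the six orders of `(x, y, s)` -/

section Relabel

/-- The `y ↔ s` mirror on patterns (`xy_s ↔ xs_y`). [folklore] -/
def Pat3.swap23 : Pat3 → Pat3
  | Pat3.xy_s => Pat3.xs_y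
  | Pat3.xs_y => Pat3.xy_s
  | P => P

/-- The `y ↔ s` mirror of a two-level member table. [folklore] -/
def mirror23 (F : ℕ → Pat3 → Pat3 → ℤ) : ℕ → Pat3 → Pat3 → ℤ := fun c P Q => F c P.swap23 Q.swap23

open scoped Classical

variable {V : Type*}

/-- Exchanging the first two marks mirrors the pattern by `Pat3.swap`. [folklore] -/
theorem pat3_swap_xy (γ : Finset (Sym2 V)) (x y s : V) : pat3 γ y x s = (pat3 γ x y s).swap := by
  have hxy := pat3_xy_iff γ x y s
  have hxs := pat3_xs_iff γ x y s
  have hys := pat3_ys_iff γ x y s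
  refine pat3_eq_of_iff ?_ ?_ ?_
  · rw [show (pat3 γ x y s).swap.xy = (pat3 γ x y s).xy by cases pat3 γ x y s <;> rfl, hxy]
    exact ⟨fun h => h.symm, fun h => h.symm⟩
  · rw [show (pat3 γ x y s).swap.xs = (pat3 γ x y s).ys by cases pat3 γ x y s <;> rfl, hys]
  · rw [show (pat3 γ x y s).swap.ys = (pat3 γ x y s).xs by cases pat3 γ x y s <;> rfl, hxs]

/-- Exchanging the last two marks mirrors the pattern by `Pat3.swap23`. [folklore] -/
theorem pat3_swap_ys (γ : Finset (Sym2 V)) (x y s : V) : pat3 γ x s y = (pat3 γ x y s).swap23 := by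
  have hxy := pat3_xy_iff γ x y s
  have hxs := pat3_xs_iff γ x y s
  have hys := pat3_ys_iff γ x y s
  refine pat3_eq_of_iff ?_ ?_ ?_
  · rw [show (pat3 γ x y s).swap23.xy = (pat3 γ x y s).xs by cases pat3 γ x y s <;> rfl, hxs]
  · rw [show (pat3 γ x y s).swap23.xs = (pat3 γ x y s).xy by cases pat3 γ x y s <;> rfl, hxy]
  · rw [show (pat3 γ x y s).swap23.ys = (pat3 γ x y s).ys by cases pat3 γ x y s <;> rfl, hys]
    exact ⟨fun h => h.symm, fun h => h.symm⟩

/-- **Levelwise values under `x ↔ y`**: the value with the first two marks exchanged is the value of the mirrored table. [folklore] -/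
theorem lev2_swap_xy (E : Finset (Sym2 V)) (x y s : V) (F : ℕ → Pat3 → Pat3 → ℤ) (μ : ℕ) :
    lev2 E y x s F μ = lev2 E x y s (mirror2 F) μ := by
  unfold lev2
  refine Finset.sum_congr rfl fun γ _ => ?_
  rw [pat3_swap_xy γ x y s, pat3_swap_xy (E \ γ) x y s]
  rfl

/-- **Levelwise values under `y ↔ s`**: the value with the last two marks exchanged is the value of the `mirror23` table. [folklore] -/
theorem lev2_swap_ys (E : Finset (Sym2 V)) (x y s : V) (F : ℕ → Pat3 → Pat3 → ℤ) (μ : ℕ) :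
    lev2 E x s y F μ = lev2 E x y s (mirror23 F) μ := by
  unfold lev2
  refine Finset.sum_congr rfl fun γ _ => ?_
  rw [pat3_swap_ys γ x y s, pat3_swap_ys (E \ γ) x y s]
  rfl

end Relabel


/-! ### From levelwise values to weighted values; `T_sym` under relabelling (census g36) -/

section LevelSums

open scoped Classical

variable {V : Type*}

/-- The weighted two-level value expands over levels: `mval2 w E F = Σ_{μ < M} w μ · lev2 E F μ` once `M` exceeds every level. [folklore] -/
theorem mval2_eq_sum_lev2 (w : ℕ → ℝ) (E : Finset (Sym2 V)) (x y s : V) (F : ℕ → Pat3 → Pat3 → ℤ) (M : ℕ)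
    (hM : ∀ γ ∈ E.powerset, apExp E γ + 2 ≤ M) :
    mval2 w E x y s F = ∑ μ ∈ Finset.range M, w μ * (lev2 E x y s F μ : ℝ) := by
  unfold mval2 lev2
  push_cast
  simp only [Finset.mul_sum]
  rw [Finset.sum_comm]
  refine Finset.sum_congr rfl fun γ hγ => ?_
  have h := hM γ hγ
  have e0 : ∀ μ : ℕ, w μ * ((if apExp E γ = μ then (F 0 (pat3 γ x y s) (pat3 (E \ γ) x y s) : ℝ) else 0) +
      (if apExp E γ + 1 = μ then (F 1 (pat3 γ x y s) (pat3 (E \ γ) x y s) : ℝ) else 0)) =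
      (if apExp E γ = μ then w (apExp E γ) * (F 0 (pat3 γ x y s) (pat3 (E \ γ) x y s) : ℝ) else 0) +
      (if apExp E γ + 1 = μ then w (apExp E γ + 1) * (F 1 (pat3 γ x y s) (pat3 (E \ γ) x y s) : ℝ) else 0) := by
    intro μ
    by_cases a : apExp E γ = μ <;> by_cases b : apExp E γ + 1 = μ
    · exfalso; omega
    · subst a; simp
    · subst b; simp
    · simp [a, b]
  simp only [e0, Finset.sum_add_distrib, Finset.sum_ite_eq, Finset.mem_range]
  rw [if_pos (by omega), if_pos (by omega)]

/-- **Levelwise nonnegativity gives nonnegativity for every nonnegative level weight.** [folklore] -/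
theorem mval2_nonneg_of_lev2 {E : Finset (Sym2 V)} {x y s : V} {F : ℕ → Pat3 → Pat3 → ℤ}
    (h : ∀ μ : ℕ, 0 ≤ lev2 E x y s F μ) {w : ℕ → ℝ} (hw : ∀ n, 0 ≤ w n) : 0 ≤ mval2 w E x y s F := by
  rw [mval2_eq_sum_lev2 w E x y s F (E.powerset.sup (fun γ => apExp E γ) + 2)
    (fun γ hγ => by have := Finset.le_sup (f := fun γ => apExp E γ) hγ; simpa using this)]
  exact Finset.sum_nonneg fun μ _ => mul_nonneg (hw μ) (by exact_mod_cast h μ)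

/-- The doubled one-level `T_sym` as a two-level table evaluates to twice `T_sym`. [folklore] -/
theorem mval2_tsym2Tab (w : ℕ → ℝ) (E : Finset (Sym2 V)) (x y s : V) :
    mval2 w E x y s tsym2Tab = 2 * tval w E x y s tsymTab := by
  rw [mval2_eq_tval_add]
  have h0 : tsym2Tab 0 = fun P Q => 2 * tsymTab P Q := by funext P Q; rfl
  have h1 : tsym2Tab 1 = fun _ _ => (0 : ℤ) := by funext P Q; rfl
  rw [h0, h1]
  unfold tval
  rw [Finset.mul_sum, ← add_zero (∑ γ ∈ E.powerset, 2 * _)]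
  congr 1
  · refine Finset.sum_congr rfl fun γ _ => ?_
    push_cast
    ring
  · exact Finset.sum_eq_zero fun γ _ => by simp

/-- From `16 · lev2 ≥ 0` at every level to `tval T_sym ≥ 0` for every nonnegative level weight. [folklore] -/
theorem tval_tsym_nonneg_of_lev2 {E : Finset (Sym2 V)} {x y s : V} {D : ℕ} (hD : 0 < D)
    (h : ∀ μ : ℕ, 0 ≤ (D : ℤ) * lev2 E x y s tsym2Tab μ) {w : ℕ → ℝ} (hw : ∀ n, 0 ≤ w n) :
    0 ≤ tval w E x y s tsymTab := by
  have h' : ∀ μ : ℕ, 0 ≤ lev2 E x y s tsym2Tab μ := fun μ =>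
    nonneg_of_mul_nonneg_right (by simpa [mul_comm] using h μ) (by exact_mod_cast hD)
  have := mval2_nonneg_of_lev2 h' hw
  rw [mval2_tsym2Tab] at this
  linarith

/-- One-level values under `x ↔ y`. [folklore] -/
theorem tval_swap_xy (w : ℕ → ℝ) (E : Finset (Sym2 V)) (x y s : V) (t : Pat3 → Pat3 → ℤ) :
    tval w E y x s t = tval w E x y s (fun P Q => t P.swap Q.swap) := by
  unfold tval
  refine Finset.sum_congr rfl fun γ _ => ?_
  rw [pat3_swap_xy γ x y s, pat3_swap_xy (E \ γ) x y s]

/-- One-level values under `y ↔ s`. [folklore] -/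
theorem tval_swap_ys (w : ℕ → ℝ) (E : Finset (Sym2 V)) (x y s : V) (t : Pat3 → Pat3 → ℤ) :
    tval w E x s y t = tval w E x y s (fun P Q => t P.swap23 Q.swap23) := by
  unfold tval
  refine Finset.sum_congr rfl fun γ _ => ?_
  rw [pat3_swap_ys γ x y s, pat3_swap_ys (E \ γ) x y s]

/-- `T_sym` is symmetric under `x ↔ y`. [folklore] -/
theorem tsymTab_swap : (fun P Q => tsymTab P.swap Q.swap) = tsymTab := by
  funext P Q; cases P <;> cases Q <;> rfl

/-- `T_sym` is symmetric under `y ↔ s`. [folklore] -/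
theorem tsymTab_swap23 : (fun P Q => tsymTab P.swap23 Q.swap23) = tsymTab := by
  funext P Q; cases P <;> cases Q <;> rfl

/-- `T_sym ≥ 0` in the marks `(b, s, t)` gives `T_sym ≥ 0` with ANY of the three marks listed first. [folklore] -/
theorem tval_tsym_nonneg_perm {E : Finset (Sym2 V)} {b s t : V} {w : ℕ → ℝ} (h : 0 ≤ tval w E b s t tsymTab) :
    0 ≤ tval w E s b t tsymTab ∧ 0 ≤ tval w E t s b tsymTab := by
  refine ⟨by rwa [tval_swap_xy, tsymTab_swap], ?_⟩
  rw [tval_swap_xy, tsymTab_swap, tval_swap_ys, tsymTab_swap23, tval_swap_xy, tsymTab_swap]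
  exact h

end LevelSums

end FK

end Summit.CriticalPhenomena.PercolationContinuityZ3.Theorems

end
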